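import Mathlib
import HarnessLib
import Summits.AnomalousDissipation.AnomalousDissipation.Theses.MomentParity
import Literature.Analysis.FluidPDE.StatisticalSolution
import Literature.Analysis.FunctionSpaces.TorusTrigPoly

/-!
# Sketch — crux-ideate QuarticGate (stmt-AnomalousDissipation-11464), ideator 1, round 1

First lemmas of the two idea cards, stated over existing declarations only (no proofs).
-/

namespace Summit.AnomalousDissipation.AnomalousDissipation.Cruxes.QuarticGate.Ideate1

open MeasureTheory Filter
open Literature.Analysis.FunctionSpaces Literature.Analysis.FluidPDE

/-- `u ∈ H` is carried by the level-`N` Fourier–Galerkin space (`û(k) = 0` off `0 < |k| ≤ N`),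
verbatim the clause of `QuarticGate`. -/
def IsLevel (N : ℕ) (u : Torus.energySpace (Fin 3)) : Prop :=
  ∀ k ∉ (Torus.freqBall N).erase (0 : Fin 3 → ℤ),
    UnitAddTorus.mFourierCoeff (EuclideanSpace.complexify ∘
      (u.1 : UnitAddTorus (Fin 3) → EuclideanSpace ℝ (Fin 3))) k = 0

/-- band-limited smooth solenoidal mean-zero test field, verbatim the clause of `QuarticGate`. -/
def IsBandTest (N : ℕ) (g : UnitAddTorus (Fin 3) → EuclideanSpace ℝ (Fin 3)) : Prop :=
  Torus.IsSmooth g ∧ Torus.IsDivFree g ∧ Torus.HasZeroMean g ∧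
    ∀ k ∉ (Torus.freqBall N).erase (0 : Fin 3 → ℤ),
      UnitAddTorus.mFourierCoeff (EuclideanSpace.complexify ∘ g) k = 0

/-- The differential `∇p(u) = Σᵢ ∂ᵢP((u,g₁),…,(u,gₘ)) gᵢ` of the polynomial cylindrical observable
`p(u) = P((u,g₁),…,(u,gₘ))`, verbatim the test-field expression of `QuarticGate`. -/
noncomputable def polyGrad {m : ℕ} (g : Fin m → UnitAddTorus (Fin 3) → EuclideanSpace ℝ (Fin 3))
    (P : MvPolynomial (Fin m) ℝ) (u : Torus.energySpace (Fin 3)) :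
    UnitAddTorus (Fin 3) → EuclideanSpace ℝ (Fin 3) :=
  fun x => ∑ i : Fin m,
    (MvPolynomial.eval (fun j => Torus.pairing u.1 (g j)) (MvPolynomial.pderiv i P)) • g i x

/-- The Euler derivative `{p, B_N}(u) = −(B(u,u), ∇p(u)) = ∫ (u ⊗ u) : ∇(∇p(u))` of the
observable `p` at a level-`N` field: the generator pairing with `ν = 0`, `f = 0`
(`nsGeneratorPairing 0 0 u w = inertialPairing u w`). -/
noncomputable def eulerDeriv {m : ℕ} (g : Fin m → UnitAddTorus (Fin 3) → EuclideanSpace ℝ (Fin 3))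
    (P : MvPolynomial (Fin m) ℝ) (u : Torus.energySpace (Fin 3)) : ℝ :=
  Torus.nsGeneratorPairing (d := Fin 3) 0 0 u (polyGrad g P u)

/-- CARD 1 (recession-cone), first lemma — the Gaussian–Liouville sign lemma: a polynomial
cylindrical observable (ANY degree) whose derivative along level-`N` Galerkin–Euler is
non-negative at every level-`N` field has identically vanishing derivative there. (Proof idea:
the isotropic level-`N` Gaussian is Galerkin–Euler invariant — Liouville `div B_N = 0` plus
`(B_N(u,u),u) = 0` — so `∫ {p,B_N} dG = 0`, and a continuous non-negative function with zero
Gaussian mean on the finite-dimensional level-`N` space vanishes.) Consequence used by the card: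
every degree-4 moment/SOS infeasibility certificate for `QuarticGate` has a cubic part that is a
Casimir of Galerkin–Euler, i.e. order-4 positivity never bites as typed. -/
def NoDefiniteEulerDerivative : Prop :=
  ∀ (N m : ℕ) (g : Fin m → UnitAddTorus (Fin 3) → EuclideanSpace ℝ (Fin 3))
    (P : MvPolynomial (Fin m) ℝ), (∀ i, IsBandTest N (g i)) →
    (∀ u : Torus.energySpace (Fin 3), IsLevel N u → 0 ≤ eulerDeriv g P u) →
    ∀ u : Torus.energySpace (Fin 3), IsLevel N u → eulerDeriv g P u = 0

/-- CARD 2 (gibbs-sea), first lemma — absolute equilibrium is exactly Euler-stationary at ALL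
moment orders: a centred Gaussian probability measure on `H` carried by level-`N` fields whose
covariance is `σ² ×` the `L²` inner product on the level-`N` space (Kraichnan's absolute
equilibrium at inverse temperature `1/(2σ²)`, zero helicity twist) annihilates the inertial part
of the generator against EVERY polynomial cylindrical test with band-limited fields (no degree
restriction). The viscous and forcing defects of this measure live in moment orders ≤ 2 only. -/
def GibbsSeaEulerStationary : Prop :=
  ∀ (N : ℕ) (σ : ℝ) (μ : Measure (Torus.energySpace (Fin 3))),
    ProbabilityTheory.IsGaussian μ →
    (∀ᵐ u ∂μ, IsLevel N u) →
    (∀ g, IsBandTest N g →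
        ∫ u, Torus.pairing u.1 g ∂μ = 0 ∧
        ∫ u, (Torus.pairing u.1 g) ^ 2 ∂μ = σ ^ 2 * ∫ x, ‖g x‖ ^ 2) →
    ∀ (m : ℕ) (g : Fin m → UnitAddTorus (Fin 3) → EuclideanSpace ℝ (Fin 3))
      (P : MvPolynomial (Fin m) ℝ), (∀ i, IsBandTest N (g i)) →
      Integrable (fun u => eulerDeriv g P u) μ ∧ ∫ u, eulerDeriv g P u ∂μ = 0

/-- Structural by-product used by both cards (design constraint on supports): a 4-stationary
level-`N` measure charges every direction that the nonlinearity feeds — if a band-limited test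
direction `e` is `μ`-a.s. frozen, `(u,e) = c`, then the instantaneous generator component
`⟨F(u), e⟩` vanishes `μ`-a.s. (take the cubic test `p = ((u,e) − c) · ⟨F(u),e⟩`-surrogate
`q` of degree 2). Stated here for the record; sparse / single-shell / lattice-gas supports die on it. -/
def FrozenDirectionRigidity : Prop :=
  ∀ (ν : ℝ) (f : UnitAddTorus (Fin 3) → EuclideanSpace ℝ (Fin 3)) (N : ℕ)
    (μ : Measure (Torus.energySpace (Fin 3))), IsProbabilityMeasure μ →
    (∀ᵐ u ∂μ, IsLevel N u) → Integrable (fun u => ‖u‖ ^ 4) μ →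
    (∀ (m : ℕ) (g : Fin m → UnitAddTorus (Fin 3) → EuclideanSpace ℝ (Fin 3))
      (P : MvPolynomial (Fin m) ℝ), (∀ i, IsBandTest N (g i)) → P.totalDegree + 1 ≤ 4 →
      Integrable (fun u => Torus.nsGeneratorPairing ν f u (polyGrad g P u)) μ ∧
      ∫ u, Torus.nsGeneratorPairing ν f u (polyGrad g P u) ∂μ = 0) →
    ∀ (e : UnitAddTorus (Fin 3) → EuclideanSpace ℝ (Fin 3)) (c : ℝ), IsBandTest N e →
      (∀ᵐ u ∂μ, Torus.pairing u.1 e = c) →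
      ∀ᵐ u ∂μ, Torus.nsGeneratorPairing ν f u e = 0

/-- Sanity: the crux decl is in scope under its route name. -/
example : Prop := Summit.AnomalousDissipation.AnomalousDissipation.Theses.MomentParity.QuarticGate

end Summit.AnomalousDissipation.AnomalousDissipation.Cruxes.QuarticGate.Ideate1
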